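import Literature.NumberTheory.EllipticCurves.Rank1Residual.X10Proofs
import Literature.NumberTheory.EllipticCurves.BSDQuadraticDescentShaOddPartGeneralProofs
import Literature.NumberTheory.EllipticCurves.KolyvaginShaIndexBound
import Literature.NumberTheory.EllipticCurves.Jetchev2008.HeegnerIndexTamagawaBound
import HarnessLib

/-!
# Class X10 ∧ r = 1: the Beilinson–Flach-FREE published route, per curve (cell `b2b-bsdres`)

HONEST FRAMING (run/shared/lean/b2b/bsd-rank1-residual/, verbatim): the goal of the cell is to
DELETE the COMBINATION-SHAPED residual classes for ALL analytic-rank `≤ 1` elliptic curves over `ℚ`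
— "full BSD formula for every rank `≤ 1` curve in class C" assembled STRICTLY from published
theorems — so that the rank-`≤ 1` remainder becomes exactly the CONSTRUCTION-SHAPED classes, which
are TYPED (missing-input `Prop`s), NOT attempted. This is not "finishing BSD".

**What this file adds (X10-AUDIT.md §9, unit `b2b-bsdres-x10-g3`).** The sub-class
X10a′ ∧ r = 1 (`p = 3` good ordinary, `E[3]` irreducible with `surj(3)`, `E` not semistable; census
`N < 10⁴`: 25 pairs, all carrying `ram(3)`) is closed as a CLASS only through Yan–Zhu 2026 Thm. 4.15,
whose `p = 3` proof rests on Beilinson–Flach reciprocity laws printed for `p ≥ 5` only (flag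
`YZ26@3-BF-ERL-Ohta`, referee R9.1/R10.1). Here is the route that AVOIDS that input, per curve: the
UPPER-bound argument of Jetchev–Skinner–Wan, Camb. J. Math. 5 (2017) §7.4.2, run on the classical
modular curve `X₀(N)` (Kolyvagin 1990 / Jetchev 2008 in place of the Shimura-curve Euler system),
together with the fact that the LOWER bound is trivial when `ord_p #Ш(E)_an = 0`:

* over a Heegner field `K = ℚ(√D)`: `ord_p #Ш(E/K)[p^∞] ≤ B`, with `B = 2·ord_p[E(K) : ℤ y_K]`
  (Kolyvagin; tree fact `Kolyvagin1990_padicValNat_card_sha_le`, McCallum 1991 §1) or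
  `B = 2·ord_p[E(K) : ℤ y_K] − 2·max_q ord_p c_q(E)` (Jetchev 2008 Cor. 1.5, fact
  `Jetchev2008.cor15_padicValNat_card_primaryComponent_sha_le`, Hypothesis (\*): `p ∤ N`, `surj(p)`);
* `Ш(E/K)[p^∞] ≅ Ш(E/ℚ)[p^∞] ⊕ Ш(E^D/ℚ)[p^∞]` for odd `p` (JSW §7.4.1 p. 30; tree theorem
  `WeierstrassCurve.card_primaryComponent_sha_baseChange_quadratic_of_odd_of_finite`);
* the twist `E^D` has analytic rank `0`, and `BSD(E^D,p)` holds by Skinner–Urban 2014 / Skinner 2016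
  Thm. C (`p = 3` allowed: (irr) and (ram) are inherited by `E^D` because the (ram) prime splits in
  `K`; tree theorem `bsdp_three_of_L_one_ne_zero_of_ram`), so `ord_p #Ш(E^D)[p^∞] = ord_p #Ш(E^D)_an`;
* hence **`ord_p #Ш(E/ℚ)[p^∞] ≤ B − ord_p #Ш(E^D)_an`** (`padicValNat_card_primaryComponent_sha_add_le_of_twist`),
  and if the per-curve CERTIFICATE `B ≤ ord_p #Ш(E^D)_an` holds together with `ord_p #Ш(E)_an = 0`,
  then `Ш(E/ℚ)[p] = 0` and `BSD(E,p)` follows with Gross–Zagier–Kolyvagin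
  (`bsdp_of_shaBaseChange_bound_of_twist`, `X10.bsdp_three_of_kolyvagin_of_twist`).

Under BSD the certificate with Jetchev's `B` holds iff `Ш(E)[p] = 0` and AT MOST ONE Tamagawa
number of `E` is divisible by `p` — exactly JSW's remark (p. 4: Kolyvagin's method "will only give
the precise upper bounds … if at most one Tamagawa number of `E` is divisible by `p`"), for EVERY
admissible `D` (the twist's `Ш` is subtracted, not required to vanish: this is what distinguishes the
lever from the census lane's rows T-KOLY/T-JET, which need the bound itself to be `0`). Census
`N < 10⁴` (job j041374, X10-AUDIT §9): of the 25 rank-one X10a′ pairs, 13 have `≤ 1` Tamagawa number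
divisible by `3` (BF-free closable, pending the lane's certificates), 12 have `≥ 2` (reachable only
through Yan–Zhu). All inputs are PUBLISHED (Kolyvagin 1990/McCallum 1991, Jetchev 2008, Skinner 2016,
Gross–Zagier–Kolyvagin) — no preprint, no Beilinson–Flach element.

Theorems only (kernel lane); named facts enter as explicit hypotheses; the per-curve certificates
(`ord_p` of the Heegner index, of the Tamagawa numbers, of `#Ш(E^D)_an`, of `#Ш(E)_an`) enter as
numeric hypotheses, as in `Typed/X10.lean`'s rank-zero appendix (`X10.bsdp_three_rankZero_surj_of_shaAn_unit`).

References: Jetchev–Skinner–Wan 2017 §7.4.1–7.4.2 [JetchevSkinnerWan2017]; Jetchev 2008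
[Jetchev2008]; McCallum 1991 [McCallumLMS1991]; Gross 1991 [GrossLMS1991]; Skinner 2016
[Skinner2016PacificMC]; Miller 2011 Def. 1.1 [Miller2011LMS]; X10-AUDIT.md §9.
-/

noncomputable section

open scoped Classical

open WeierstrassCurve Literature.NumberTheory.EllipticCurves

namespace Literature.NumberTheory.EllipticCurves.Rank1Residual

/-! ## The subtraction step (JSW 2017 §7.4.2 on `X₀(N)`), any odd `p` -/

/-- **Upper bound over `ℚ` from an upper bound over `K` and a lower bound for the twist**
(Jetchev–Skinner–Wan 2017, §7.4.2, the step "Appealing to part (ii) or (iii) of Theorem (thm:rank0)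
(for `𝓔 = E^{D''}`) then yields `ord_p(#Ш(E/ℚ)[p^∞]) ≤ …`", with §7.4.1's
"`Ш(E/K)[p^∞] ≅ Ш(E/ℚ)[p^∞] ⊕ Ш(E^{D}/ℚ)[p^∞]`"): for `E/ℚ`, a quadratic field `K`, a `ℚ`-model
`Wd` of `E^{(d_K)}` and an odd prime `p` with `Ш(E)[p^∞]`, `Ш(E^{(d_K)})[p^∞]` finite, if
`ord_p #Ш(E_K/K)[p^∞] ≤ B` and `L ≤ ord_p #Ш(E^{(d_K)}/ℚ)[p^∞]` then `ord_p #Ш(E/ℚ)[p^∞] + L ≤ B`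
(`card_primaryComponent_sha_baseChange_quadratic_of_odd_of_finite`, `padicValNat.mul`).
[cite: JetchevSkinnerWan2017, §7.4.1 (p. 30) and §7.4.2 (p. 31)] -/
theorem padicValNat_card_primaryComponent_sha_add_le_of_twist
    (W : WeierstrassCurve ℚ) [W.IsElliptic] (K : Type) [Field K] [NumberField K]
    (h2 : Module.finrank ℚ K = 2) (Wd : WeierstrassCurve ℚ) [Wd.IsElliptic]
    (hWd : ∃ C : VariableChange ℚ, C • W.quadraticTwist (NumberField.discr K : ℚ) = Wd)
    (p : ℕ) [Fact p.Prime] (hp : p ≠ 2)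
    [Finite (AddCommGroup.primaryComponent W.sha p)]
    [Finite (AddCommGroup.primaryComponent Wd.sha p)] {B L : ℕ}
    (hK : padicValNat p (Nat.card (AddCommGroup.primaryComponent (W.baseChange K).sha p)) ≤ B)
    (hL : L ≤ padicValNat p (Nat.card (AddCommGroup.primaryComponent Wd.sha p))) :
    padicValNat p (Nat.card (AddCommGroup.primaryComponent W.sha p)) + L ≤ B := by
  haveI : (W.baseChange K).IsElliptic := by rw [WeierstrassCurve.baseChange]; infer_instance
  have hprod := W.card_primaryComponent_sha_baseChange_quadratic_of_odd_of_finite K h2 Wd hWd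
    (W.baseChange K) ⟨1, one_smul _ _⟩ p hp
  have ha : Nat.card (AddCommGroup.primaryComponent W.sha p) ≠ 0 := Nat.card_pos.ne'
  have hb : Nat.card (AddCommGroup.primaryComponent Wd.sha p) ≠ 0 := Nat.card_pos.ne'
  rw [hprod, padicValNat.mul ha hb] at hK
  omega

/-- **`BSD(E,p)` from a `K`-level bound, the twist's `p`-part and two certificates**, any odd `p`,
analytic rank `≤ 1` (the BF-free lever of X10-AUDIT §9 in Miller's currency). Granted
Gross–Zagier–Kolyvagin (`hGZK`: `rank = r_an`, `Ш(E)` finite): if `ord_p #Ш(E_K/K)[p^∞] ≤ B`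
(Kolyvagin / Jetchev output, `hK`), `BSD(E^{(d_K)},p)` holds (`hD`, e.g. Skinner 2016 Thm. C for the
rank-`0` twist) with `B ≤ ord_p #Ш(E^{(d_K)})_an` (certificate `hDB`), and `ord_p #Ш(E)_an = 0`
(certificate `hunit`), then `Ш(E/ℚ)[p] = 0` by the subtraction step and `BSD(E,p)` holds.
[cite: JetchevSkinnerWan2017, §7.4.2 (p. 31)] [cite: Miller2011LMS, Def. 1.1] -/
theorem bsdp_of_shaBaseChange_bound_of_twist
    (hGZK : rank_eq_analyticRank_of_analyticRank_le_one)
    (W : WeierstrassCurve ℚ) [W.IsElliptic] (hr : W.analyticRank ≤ 1)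
    (K : Type) [Field K] [NumberField K] (h2 : Module.finrank ℚ K = 2)
    (Wd : WeierstrassCurve ℚ) [Wd.IsElliptic]
    (hWd : ∃ C : VariableChange ℚ, C • W.quadraticTwist (NumberField.discr K : ℚ) = Wd)
    (p : ℕ) [Fact p.Prime] (hp : p ≠ 2) {B : ℕ}
    (hK : padicValNat p (Nat.card (AddCommGroup.primaryComponent (W.baseChange K).sha p)) ≤ B)
    (hD : BSDp Wd p) (hDB : ∃ q : ℚ, shaAn Wd = (q : ℂ) ∧ (B : ℤ) ≤ padicValRat p q)
    (hunit : ∃ q : ℚ, shaAn W = (q : ℂ) ∧ padicValRat p q = 0) : BSDp W p := by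
  obtain ⟨hrank, hfin⟩ := hGZK W hr
  haveI : Finite W.sha := hfin
  haveI : Finite (AddCommGroup.primaryComponent W.sha p) :=
    Finite.of_injective _ Subtype.val_injective
  obtain ⟨-, hfinD, qD, hqD, hvD⟩ := hD
  haveI : Finite (AddCommGroup.primaryComponent Wd.sha p) := hfinD
  obtain ⟨qD', hqD', hB⟩ := hDB
  have hqq : qD' = qD := by exact_mod_cast hqD'.symm.trans hqD
  subst hqq
  rw [hvD] at hB
  have hB' : B ≤ padicValNat p (Nat.card (AddCommGroup.primaryComponent Wd.sha p)) := by
    exact_mod_cast hB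
  have hle := padicValNat_card_primaryComponent_sha_add_le_of_twist W K h2 Wd hWd p hp hK hB'
  have h0 : padicValNat p (Nat.card (AddCommGroup.primaryComponent W.sha p)) = 0 := by omega
  obtain ⟨q, hq, hv⟩ := hunit
  exact ⟨hrank, inferInstance, q, hq, by rw [hv, h0, Nat.cast_zero]⟩

/-! ## With Kolyvagin's bound as printed (McCallum 1991 §1): `B = 2·ord_p [E(K) : ℤ y_K]` -/

/-- **Kolyvagin's bound with the twist subtracted** (any odd `p`, analytic rank `≤ 1`): granted the
named facts `kolyvagin N W K` (finiteness of `Ш(E/K)`) and `Kolyvagin1990_padicValNat_card_sha_le N W K`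
(McCallum 1991 §1: `ord_p #Ш(E/K) ≤ 2·ord_p[E(K) : ℤ y_K]` for odd `p` with `ρ̄_{E,p}` onto) and GZK:
for a Heegner point `P = y_K` of infinite order over an imaginary quadratic `K` with the Heegner
hypothesis for `N`, if `BSD(E^{(d_K)},p)` holds with the certificate
`2·ord_p[E(K) : ℤ P] ≤ ord_p #Ш(E^{(d_K)})_an` and `ord_p #Ш(E)_an = 0`, then `BSD(E,p)`. This fires
(under BSD) iff `Ш(E)[p] = 0` and NO Tamagawa number of `E` is divisible by `p`, for every admissible
`K` — also when `Ш(E^{(d_K)})[p] ≠ 0`, where the census row T-KOLY cannot (X10-AUDIT §9: census pairs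
`5320a1@3`, `6440f1@3`, `6650z1@3`). [cite: McCallumLMS1991, §1 Theorem (Kolyvagin), p. 296]
[cite: JetchevSkinnerWan2017, §7.4.2 (p. 31)] [cite: Miller2011LMS, Def. 1.1] -/
theorem bsdp_of_kolyvagin_of_twist {N : ℕ} [NeZero N]
    (hGZK : rank_eq_analyticRank_of_analyticRank_le_one)
    (W : WeierstrassCurve ℚ) [W.IsElliptic] (hr : W.analyticRank ≤ 1)
    (K : Type) [Field K] [NumberField K]
    (hKo : kolyvagin N W K) (hKB : Kolyvagin1990_padicValNat_card_sha_le N W K)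
    (hK : IsImaginaryQuadratic K) (hH : SatisfiesHeegnerHypothesis N K)
    {P : (W.baseChange K).toAffine.Point} (hP : IsHeegnerPoint N W K P) (hnt : ¬ IsOfFinAddOrder P)
    (p : ℕ) [Fact p.Prime] (hp : p ≠ 2) (hρ : W.HasSurjectiveModNGaloisRep p)
    (Wd : WeierstrassCurve ℚ) [Wd.IsElliptic]
    (hWd : ∃ C : VariableChange ℚ, C • W.quadraticTwist (NumberField.discr K : ℚ) = Wd)
    (hD : BSDp Wd p)
    (hDB : ∃ q : ℚ, shaAn Wd = (q : ℂ) ∧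
      ((2 * padicValNat p (AddSubgroup.zmultiples P).index : ℕ) : ℤ) ≤ padicValRat p q)
    (hunit : ∃ q : ℚ, shaAn W = (q : ℂ) ∧ padicValRat p q = 0) : BSDp W p := by
  obtain ⟨-, hfinK⟩ := hKo hK hH hP hnt
  haveI : Finite ((W.baseChange K).sha) := hfinK
  have hbound := hKB hK hH hP hnt (Fact.out : p.Prime) hp hρ
  rw [← padicValNat_card_addPrimaryComponent (A := (W.baseChange K).sha) p] at hbound
  exact bsdp_of_shaBaseChange_bound_of_twist hGZK W hr K hK.1 Wd hWd p hp hbound hD hDB hunit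

/-! ## Class X10 at `p = 3`, rank one: the canonical shapes -/

/-- **X10 ∧ r = 1 WITHOUT Yan–Zhu — the BF-free per-curve route at `p = 3`** (X10-AUDIT §9): for
`E/ℚ` in class X10 (`p = 3` good ordinary, `E[3]` irreducible) of analytic rank `1` with `surj(3)`,
a Heegner field `K` (imaginary quadratic, Heegner hypothesis for `N`) with Heegner point `P = y_K` of
infinite order, and a `ℚ`-model `Wd` of the twist `E^{(d_K)}`: granted GZK, Kolyvagin's theorem and
bound (PUBLISHED named facts `kolyvagin`, `Kolyvagin1990_padicValNat_card_sha_le`), `BSD(E^{(d_K)},3)`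
(`hD`; discharged from Skinner 2016 Thm. C by `X10.bsdp_three_rankOne_of_kolyvagin_of_skinner`
below) and the two certificates `2·ord_3[E(K) : ℤ P] ≤ ord_3 #Ш(E^{(d_K)})_an`, `ord_3 #Ш(E)_an = 0`,
Miller's `BSD(E,3)` holds. No Beilinson–Flach input; statement PUB, proof inputs PUB.
[cite: McCallumLMS1991, §1 Theorem (Kolyvagin), p. 296] [cite: JetchevSkinnerWan2017, §7.4.2 (p. 31)]
[cite: Miller2011LMS, Def. 1.1] -/
theorem X10.bsdp_three_rankOne_of_kolyvagin_of_twist {N : ℕ} [NeZero N]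
    (hGZK : rank_eq_analyticRank_of_analyticRank_le_one)
    (W : WeierstrassCurve ℚ) [W.IsElliptic] [W.IsGloballyMinimal]
    (hX : ClassX10 W 3) (hsurj : Surj W 3)
    (K : Type) [Field K] [NumberField K]
    (hKo : kolyvagin N W K) (hKB : Kolyvagin1990_padicValNat_card_sha_le N W K)
    (hK : IsImaginaryQuadratic K) (hH : SatisfiesHeegnerHypothesis N K)
    {P : (W.baseChange K).toAffine.Point} (hP : IsHeegnerPoint N W K P) (hnt : ¬ IsOfFinAddOrder P)
    (Wd : WeierstrassCurve ℚ) [Wd.IsElliptic]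
    (hWd : ∃ C : VariableChange ℚ, C • W.quadraticTwist (NumberField.discr K : ℚ) = Wd)
    (hD : BSDp Wd 3)
    (hDB : ∃ q : ℚ, shaAn Wd = (q : ℂ) ∧
      ((2 * padicValNat 3 (AddSubgroup.zmultiples P).index : ℕ) : ℤ) ≤ padicValRat 3 q)
    (hunit : ∃ q : ℚ, shaAn W = (q : ℂ) ∧ padicValRat 3 q = 0) : BSDp W 3 :=
  bsdp_of_kolyvagin_of_twist hGZK W hX.analyticRank_le_one K hKo hKB hK hH hP hnt 3 (by decide)
    hsurj Wd hWd hD hDB hunit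

/-- **The same with `BSD(E^{(d_K)},3)` discharged from Skinner 2016 Thm. C** (tree theorem
`bsdp_three_of_L_one_ne_zero_of_ram`; named fact `hSk`): the twist `Wd` (a globally minimal model of
`E^{(d_K)}`) has good ordinary or multiplicative reduction at `3` (`hredD`; good ordinary when
`3 ∤ d_K`), `E^{(d_K)}[3] ≅ E[3] ⊗ χ_K` irreducible (`hirrD`), a ramified multiplicative prime
(`hramD`: the (ram) prime `ℓ` of `E` splits in `K`, so `E^{(d_K)} ≅ E` over `ℚ_ℓ`), and
`L(E^{(d_K)},1) ≠ 0` (`hLD`, the choice of `K`). These four facts about the twist are hypotheses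
here (decided per curve by the census engines), not derived. [cite: Skinner2016PacificMC, Thm. C (§1)]
[cite: McCallumLMS1991, §1 Theorem (Kolyvagin), p. 296] [cite: JetchevSkinnerWan2017, §7.4.2 (p. 31)] -/
theorem X10.bsdp_three_rankOne_of_kolyvagin_of_skinner {N : ℕ} [NeZero N]
    (hSk : Skinner2016.thmC_padicValRat_bsd_rank_zero)
    (hGZK : rank_eq_analyticRank_of_analyticRank_le_one)
    (W : WeierstrassCurve ℚ) [W.IsElliptic] [W.IsGloballyMinimal]
    (hX : ClassX10 W 3) (hsurj : Surj W 3)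
    (K : Type) [Field K] [NumberField K]
    (hKo : kolyvagin N W K) (hKB : Kolyvagin1990_padicValNat_card_sha_le N W K)
    (hK : IsImaginaryQuadratic K) (hH : SatisfiesHeegnerHypothesis N K)
    {P : (W.baseChange K).toAffine.Point} (hP : IsHeegnerPoint N W K P) (hnt : ¬ IsOfFinAddOrder P)
    (Wd : WeierstrassCurve ℚ) [Wd.IsElliptic] [Wd.IsGloballyMinimal]
    (hWd : ∃ C : VariableChange ℚ, C • W.quadraticTwist (NumberField.discr K : ℚ) = Wd)
    (hredD : (Wd.HasGoodReductionAtPrime 3 ∧ ¬ (3 : ℤ) ∣ Wd.frobeniusTrace 3) ∨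
      Wd.HasMultiplicativeReductionAtPrime 3)
    (hirrD : Wd.HasIrreducibleModPGaloisRep 3)
    (hramD : ∃ ℓ : ℕ, ∃ _ : Fact ℓ.Prime, ℓ ≠ 3 ∧ Wd.HasMultiplicativeReductionAtPrime ℓ ∧
      ¬ 3 ∣ padicValInt ℓ Wd.minimalDiscriminantInt)
    (hLD : Wd.entireLFunction 1 ≠ 0)
    (hDB : ∃ q : ℚ, shaAn Wd = (q : ℂ) ∧
      ((2 * padicValNat 3 (AddSubgroup.zmultiples P).index : ℕ) : ℤ) ≤ padicValRat 3 q)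
    (hunit : ∃ q : ℚ, shaAn W = (q : ℂ) ∧ padicValRat 3 q = 0) : BSDp W 3 :=
  X10.bsdp_three_rankOne_of_kolyvagin_of_twist hGZK W hX hsurj K hKo hKB hK hH hP hnt Wd hWd
    (bsdp_three_of_L_one_ne_zero_of_ram hSk hGZK hredD hirrD hramD hLD) hDB hunit

/-! ### Appendix (2026-08-18, X10-AUDIT.md §9.5): Jetchev's sharpening — `B = 2·ord_p[E(K) : ℤ y_K] − 2·ord_p c_q(E)`

With the named fact `Jetchev2008.cor15_padicValNat_card_primaryComponent_sha_le` (Jetchev, Compos.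
Math. 144 (2008) Cor. 1.5, vendored in the monotone form "for every prime `q ∣ N`:
`ord_p #Ш(E/K)[p^∞] + 2·ord_p c_q ≤ 2·ord_p [E(K) : ℤ y_K]`", Hypothesis (\*): `p ∤ N` and `ρ̄_{E,p}`
surjective) the `K`-level bound of `bsdp_of_shaBaseChange_bound_of_twist` improves by the Tamagawa
number at any ONE bad prime `q` (take `q` with `ord_p c_q` maximal for Cor. 1.5 verbatim): lever L11 of
X10-AUDIT §9.2, which under BSD fires iff `Ш(E)[p] = 0` and at most one Tamagawa number of `E` is
divisible by `p` (Jetchev's "In particular, if `p` divides at most one Tamagawa number …"). -/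

/-- **Jetchev's bound with the twist subtracted** (any odd good `p ∤ N` with `ρ̄_{E,p}` onto, analytic
rank `≤ 1`): granted GZK and Jetchev 2008 Cor. 1.5 (`hJ`), for an optimal `E` (`hopt`), a Heegner
field `K` (`d_K ≠ -3`) with Heegner point `P = y_K` of infinite order and a prime `q ∣ N`: if
`BSD(E^{(d_K)},p)` holds (`hD`) with the certificate
`2·ord_p[E(K) : ℤ P] − 2·ord_p c_q(E) ≤ ord_p #Ш(E^{(d_K)})_an` and `ord_p #Ш(E)_an = 0`, then
`BSD(E,p)`. [cite: Jetchev2008, Cor. 1.5 (p. 3)] [cite: JetchevSkinnerWan2017, §7.4.2 (p. 31)]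
[cite: Miller2011LMS, Def. 1.1] -/
theorem bsdp_of_jetchev_of_twist {N : ℕ} [NeZero N]
    (hJ : Jetchev2008.cor15_padicValNat_card_primaryComponent_sha_le)
    (hGZK : rank_eq_analyticRank_of_analyticRank_le_one)
    (W : WeierstrassCurve ℚ) [W.IsElliptic] (hr : W.analyticRank ≤ 1)
    (K : Type) [Field K] [NumberField K]
    (hK : IsImaginaryQuadratic K) (hD3 : NumberField.discr K ≠ -3)
    (hH : SatisfiesHeegnerHypothesis N K)
    (hopt : ∃ Dt : ModularForms.ModularParametrizationData W N,
      ∀ z ∈ Dt.L.lattice, ∃ w ∈ ModularForms.periodLattice Dt.f, z = (Dt.c : ℂ) * w)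
    {P : (W.baseChange K).toAffine.Point} (hP : IsHeegnerPoint N W K P) (hnt : ¬ IsOfFinAddOrder P)
    (p : ℕ) [Fact p.Prime] (hp : p ≠ 2) (hpN : ¬ p ∣ N) (hρ : W.HasSurjectiveModNGaloisRep p)
    (q : ℕ) [Fact q.Prime] (hqN : q ∣ N)
    (Wd : WeierstrassCurve ℚ) [Wd.IsElliptic]
    (hWd : ∃ C : VariableChange ℚ, C • W.quadraticTwist (NumberField.discr K : ℚ) = Wd)
    (hD : BSDp Wd p)
    (hDB : ∃ r : ℚ, shaAn Wd = (r : ℂ) ∧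
      ((2 * padicValNat p (AddSubgroup.zmultiples P).index -
          2 * padicValNat p ((W.baseChange ℚ_[q]).localTamagawaNumber ℤ_[q]) : ℕ) : ℤ) ≤
        padicValRat p r)
    (hunit : ∃ r : ℚ, shaAn W = (r : ℂ) ∧ padicValRat p r = 0) : BSDp W p := by
  have hb := hJ N W K hK hD3 hH hopt hP hnt p hp hpN hρ q hqN
  have hK' : padicValNat p (Nat.card (AddCommGroup.primaryComponent (W.baseChange K).sha p)) ≤
      2 * padicValNat p (AddSubgroup.zmultiples P).index -
        2 * padicValNat p ((W.baseChange ℚ_[q]).localTamagawaNumber ℤ_[q]) := by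
    omega
  exact bsdp_of_shaBaseChange_bound_of_twist hGZK W hr K hK.1 Wd hWd p hp hK' hD hDB hunit

/-- **X10 ∧ r = 1 WITHOUT Yan–Zhu, Jetchev form (lever L11 of X10-AUDIT §9.2) with the twist's
`BSD(E^{(d_K)},3)` discharged from Skinner 2016 Thm. C.** For an optimal `E/ℚ` in class X10 with
`surj(3)`, a Heegner field `K` (`d_K ≠ -3`, Heegner hypothesis for a level `N` with `3 ∤ N`), Heegner
point `P = y_K` of infinite order, a prime `q ∣ N`, and a globally minimal model `Wd` of `E^{(d_K)}`
that is good ordinary or multiplicative at `3`, with `E^{(d_K)}[3]` irreducible, a ramified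
multiplicative prime and `L(E^{(d_K)},1) ≠ 0`: granted GZK, Jetchev 2008 Cor. 1.5 and Skinner 2016
Thm. C (named facts, all PUBLISHED), the certificates
`2·ord_3[E(K) : ℤ P] − 2·ord_3 c_q(E) ≤ ord_3 #Ш(E^{(d_K)})_an` and `ord_3 #Ш(E)_an = 0` give
`BSD(E,3)`. No Beilinson–Flach input. Census `N < 10⁴` (X10-AUDIT §9.3): BSD predicts the first
certificate for 13 of the 25 rank-one X10a′ pairs (those with at most one Tamagawa number divisible
by `3`). [cite: Jetchev2008, Cor. 1.5 (p. 3)] [cite: Skinner2016PacificMC, Thm. C (§1)]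
[cite: JetchevSkinnerWan2017, §7.4.2 (p. 31)] [cite: Miller2011LMS, Def. 1.1] -/
theorem X10.bsdp_three_rankOne_of_jetchev_of_skinner {N : ℕ} [NeZero N]
    (hJ : Jetchev2008.cor15_padicValNat_card_primaryComponent_sha_le)
    (hSk : Skinner2016.thmC_padicValRat_bsd_rank_zero)
    (hGZK : rank_eq_analyticRank_of_analyticRank_le_one)
    (W : WeierstrassCurve ℚ) [W.IsElliptic] [W.IsGloballyMinimal]
    (hX : ClassX10 W 3) (hsurj : Surj W 3) (h3N : ¬ 3 ∣ N)
    (K : Type) [Field K] [NumberField K]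
    (hK : IsImaginaryQuadratic K) (hD3 : NumberField.discr K ≠ -3)
    (hH : SatisfiesHeegnerHypothesis N K)
    (hopt : ∃ Dt : ModularForms.ModularParametrizationData W N,
      ∀ z ∈ Dt.L.lattice, ∃ w ∈ ModularForms.periodLattice Dt.f, z = (Dt.c : ℂ) * w)
    {P : (W.baseChange K).toAffine.Point} (hP : IsHeegnerPoint N W K P) (hnt : ¬ IsOfFinAddOrder P)
    (q : ℕ) [Fact q.Prime] (hqN : q ∣ N)
    (Wd : WeierstrassCurve ℚ) [Wd.IsElliptic] [Wd.IsGloballyMinimal]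
    (hWd : ∃ C : VariableChange ℚ, C • W.quadraticTwist (NumberField.discr K : ℚ) = Wd)
    (hredD : (Wd.HasGoodReductionAtPrime 3 ∧ ¬ (3 : ℤ) ∣ Wd.frobeniusTrace 3) ∨
      Wd.HasMultiplicativeReductionAtPrime 3)
    (hirrD : Wd.HasIrreducibleModPGaloisRep 3)
    (hramD : ∃ ℓ : ℕ, ∃ _ : Fact ℓ.Prime, ℓ ≠ 3 ∧ Wd.HasMultiplicativeReductionAtPrime ℓ ∧
      ¬ 3 ∣ padicValInt ℓ Wd.minimalDiscriminantInt)
    (hLD : Wd.entireLFunction 1 ≠ 0)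
    (hDB : ∃ r : ℚ, shaAn Wd = (r : ℂ) ∧
      ((2 * padicValNat 3 (AddSubgroup.zmultiples P).index -
          2 * padicValNat 3 ((W.baseChange ℚ_[q]).localTamagawaNumber ℤ_[q]) : ℕ) : ℤ) ≤
        padicValRat 3 r)
    (hunit : ∃ r : ℚ, shaAn W = (r : ℂ) ∧ padicValRat 3 r = 0) : BSDp W 3 :=
  bsdp_of_jetchev_of_twist hJ hGZK W hX.analyticRank_le_one K hK hD3 hH hopt hP hnt 3 (by decide)
    h3N hsurj q hqN Wd hWd (bsdp_three_of_L_one_ne_zero_of_ram hSk hGZK hredD hirrD hramD hLD)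
    hDB hunit

end Literature.NumberTheory.EllipticCurves.Rank1Residual

end
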